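import Summits.QuantumFields.YangMills.Theorems.LuscherReductionTwistedTraceScalingBODualProfile
import Summits.QuantumFields.YangMills.Theorems.LuscherReductionTwistedTraceScalingBOCapProfile
import Summits.QuantumFields.YangMills.Theorems.LuscherReductionTwistedTraceScalingBODefect
import HarnessLib

/-!
# (C4)-CORE ★★★ the weighted `L²` size of the quasimode defect on the INNER CORE region
# (lane A of S-BASE, crux `TwistedTraceScaling` stmt-QuantumFields-20203, C4-CORE, the (OD) pen; COARSE-DESIGN §27.3 (a) / §27.7 (C4))

The `L²(w)` door `…BODefect.hOD_of_defect` asks for `∫ E²w ≤ (bΛ)²‖φ⊗Ω‖²_w` with `E = 𝟙_S(K̃(φ⊗Ω)/w − ψ⊗Ω)`, `w = N/χ`.  This file bounds the CORE part of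
`∫ E²w` — the region `S_in = {U ∈ orthoTubeSet : χ U ≠ 0, ‖relLinkVec U‖ ≤ R_in, slowMean U ∈ W_out}` — for a weight of record shape
`χ = 𝟙_F·e^{−gaugeCoordSq/(powScale 1 β)²}` with the (P) sandwich `N̄(1−κ) ≤ N ≤ N̄(1+κ)` on `F`, the cap-restricted frozen profile
`Ω_c = 𝟙_cap·e^{−‖P_Γx‖²/(powScale 1 β)²}e^{−q}𝟙_{‖x‖≤r}`, and ANY function `K` (think `K = K̃(φ⊗Ω_c)`) obeying the POINTWISE CORE QUASIMODE ESTIMATE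
`|K(oT u' v') − Z⁻¹a₀e^{−q(x')}·P(u')| ≤ ε·Z⁻¹a₀e^{−q(x')}·P_a(u')` (`|P| ≤ P_a`; for the record data this is `…BOCoreDefectRate.core_defect_rate` with
`P = ∫φρ̃`, `P_a = ∫|φ|ρ̃`, `a₀ = c₁·stiffGaussTop/I₀`).  With the dual amplitude `ψ = Z⁻¹a₀P/N̄`:
* `defect_core_pointwise` — the real-number heart: `(K/w − ψΩ_c)²·w = (K − ψe^{−q}N)²·χ/N ≤ (Z⁻¹a₀(ε+κ))²/(N̄(1−κ))·e^{−2q}χ·P_a²`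
  (the dual-profile cancellation `Ω_c·w = e^{−q}N`, `|N/N̄ − 1| ≤ κ`, and `1/w = χ/N` — the factor `χ = e^{−‖P_Γx'‖²β²}` is KEPT: it is what makes the
  gauge-far directions integrable);
* ★★★ `defect_core_sq_integral_le` — integrating over `S_in` by the tube disintegration `∫_U = ∫_v∫_u` (`integral_configMeasure_orthoTube`):
  `∫ 𝟙_{S_in}(K/w − ψ⊗Ω_c)²w ≤ (Z⁻¹a₀(ε+κ))²/(N̄(1−κ)) · (∫_{‖x‖≤R_in} e^{−2q}e^{−‖P_Γx‖²/(powScale 1 β)²} dπ) · ∫ P_a²`.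
The slow factor `∫P_a² ≤ (linkCE/K₁(1,1))²∫φ²` is `…BOSlowSchur.sq_integral_avgKernel_one_le`; the fibre factor is `≤ recordGamma/N̄`; the complement
`S ∖ S_in` is (C5).
HONEST FRAMING: the (C4)-core `L²` estimate for a stub of a child of the CONDITIONAL route R2b1; (C5), the final `b`, (B-ST), C4-CORE OPEN; not infinite volume,
not a gap, not Clay.
-/

set_option autoImplicit false

noncomputable section

open MeasureTheory Filter Topology Real
open scoped BigOperators
open Literature.MathematicalPhysics.QuantumFieldTheory
open Literature.MathematicalPhysics.QuantumLattice

namespace Summit.QuantumFields.YangMills.Theorems.FemtoTransferGap.TwoLattice.ConstTube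

open Summit.QuantumFields.YangMills.Theorems.FemtoTransferGap
open Summit.QuantumFields.YangMills.Theorems.FemtoTransferGap.TwoLattice
open Summit.QuantumFields.YangMills.Theorems.FemtoTransferGap.TwoLattice.Avg
open Summit.QuantumFields.YangMills.Theorems.FemtoTransferGap.TwoLattice.Stiff
open Summit.QuantumFields.YangMills.Theorems.FemtoTransferGap.TwoLattice.GnChart

variable {L : ℕ} [NeZero L]

/-! ## §1 The real-number heart -/

omit [NeZero L] in
/-- **Pointwise core defect.**  Reals: `N̄(1−κ) ≤ N ≤ N̄(1+κ)`, `N̄(1−κ) > 0`, `κ ≥ 0`, `0 < g` (the gauge Gaussian value `χ(U)`), `0 ≤ e` (`e^{−q}`), `Z⁻¹, a₀, ε ≥ 0`,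
`|P| ≤ P_a`, and the quasimode estimate `|K − Z⁻¹(a₀e)P| ≤ ε·Z⁻¹(a₀e)P_a`.  Then with `w = N/g` and `ψ = Z⁻¹a₀P/N̄`:
`(K/w − ψ·(g·e))²·w ≤ (Z⁻¹a₀(ε+κ))²/(N̄(1−κ))·(e²g)·P_a²`. [folklore] -/
theorem defect_core_pointwise {K N Nbar κ g e Zi a₀ ε P Pa : ℝ} (hN : Nbar * (1 - κ) ≤ N ∧ N ≤ Nbar * (1 + κ)) (hNκ : 0 < Nbar * (1 - κ)) (hκ : 0 ≤ κ)
    (hg : 0 < g) (he : 0 ≤ e) (hZi : 0 ≤ Zi) (ha₀ : 0 ≤ a₀) (hε : 0 ≤ ε) (hP : |P| ≤ Pa)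
    (hdef : |K - Zi * (a₀ * e) * P| ≤ ε * (Zi * (a₀ * e) * Pa)) :
    (K / (N / g) - Zi * a₀ / Nbar * P * (g * e)) ^ 2 * (N / g) ≤ (Zi * a₀ * (ε + κ)) ^ 2 / (Nbar * (1 - κ)) * (e ^ 2 * g) * Pa ^ 2 := by
  have hNbar : 0 < Nbar := by
    rcases lt_or_ge 0 Nbar with h | h
    · exact h
    · nlinarith
  have hNpos : 0 < N := lt_of_lt_of_le hNκ hN.1
  have hPa : 0 ≤ Pa := (abs_nonneg _).trans hP
  have hA : 0 ≤ Zi * (a₀ * e) := mul_nonneg hZi (mul_nonneg ha₀ he)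
  -- `|N/N̄ − 1| ≤ κ`
  have hratio : |N / Nbar - 1| ≤ κ := by
    rw [abs_le]
    constructor
    · rw [le_sub_iff_add_le, le_div_iff₀ hNbar]; linarith [hN.1]
    · rw [sub_le_iff_le_add, div_le_iff₀ hNbar]; linarith [hN.2]
  -- the total defect `|K − ψ e N| ≤ Z⁻¹a₀e(ε+κ)P_a`
  have hkey : |K - Zi * a₀ / Nbar * P * (g * e) * (N / g)| ≤ Zi * (a₀ * e) * (ε + κ) * Pa := by
    have e1 : Zi * a₀ / Nbar * P * (g * e) * (N / g) = Zi * (a₀ * e) * P * (N / Nbar) := by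
      field_simp
    rw [e1]
    have h2 : |Zi * (a₀ * e) * P - Zi * (a₀ * e) * P * (N / Nbar)| ≤ Zi * (a₀ * e) * Pa * κ := by
      have e2 : Zi * (a₀ * e) * P - Zi * (a₀ * e) * P * (N / Nbar) = -(Zi * (a₀ * e) * P * (N / Nbar - 1)) := by ring
      rw [e2, abs_neg, abs_mul, abs_mul, abs_of_nonneg hA]
      exact mul_le_mul (mul_le_mul_of_nonneg_left hP hA) hratio (abs_nonneg _) (mul_nonneg hA hPa)
    calc |K - Zi * (a₀ * e) * P * (N / Nbar)| = |(K - Zi * (a₀ * e) * P) + (Zi * (a₀ * e) * P - Zi * (a₀ * e) * P * (N / Nbar))| := by ring_nf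
      _ ≤ |K - Zi * (a₀ * e) * P| + |Zi * (a₀ * e) * P - Zi * (a₀ * e) * P * (N / Nbar)| := abs_add_le _ _
      _ ≤ ε * (Zi * (a₀ * e) * Pa) + Zi * (a₀ * e) * Pa * κ := add_le_add hdef h2
      _ = Zi * (a₀ * e) * (ε + κ) * Pa := by ring
  -- `(K/w − ψge)²w = (K − ψgeN/g)²·(g/N)`
  have hw : 0 < N / g := div_pos hNpos hg
  have e3 : (K / (N / g) - Zi * a₀ / Nbar * P * (g * e)) ^ 2 * (N / g) = (K - Zi * a₀ / Nbar * P * (g * e) * (N / g)) ^ 2 / (N / g) := by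
    field_simp
  rw [e3, div_le_iff₀ hw]
  have hsq : (K - Zi * a₀ / Nbar * P * (g * e) * (N / g)) ^ 2 ≤ (Zi * (a₀ * e) * (ε + κ) * Pa) ^ 2 := by
    have h0 : 0 ≤ Zi * (a₀ * e) * (ε + κ) * Pa := by positivity
    calc (K - Zi * a₀ / Nbar * P * (g * e) * (N / g)) ^ 2 = |K - Zi * a₀ / Nbar * P * (g * e) * (N / g)| ^ 2 := (sq_abs _).symm
      _ ≤ (Zi * (a₀ * e) * (ε + κ) * Pa) ^ 2 := pow_le_pow_left₀ (abs_nonneg _) hkey 2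
  -- `(Z⁻¹a₀e(ε+κ)P_a)² ≤ C²/(N̄(1−κ))·e²g·P_a²·(N/g)` since `N ≥ N̄(1−κ)`
  have hrhs : (Zi * (a₀ * e) * (ε + κ) * Pa) ^ 2 ≤ (Zi * a₀ * (ε + κ)) ^ 2 / (Nbar * (1 - κ)) * (e ^ 2 * g) * Pa ^ 2 * (N / g) := by
    have e4 : (Zi * a₀ * (ε + κ)) ^ 2 / (Nbar * (1 - κ)) * (e ^ 2 * g) * Pa ^ 2 * (N / g) =
        (Zi * (a₀ * e) * (ε + κ) * Pa) ^ 2 * (N / (Nbar * (1 - κ))) := by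
      field_simp
    rw [e4]
    have h1 : 1 ≤ N / (Nbar * (1 - κ)) := by rw [le_div_iff₀ hNκ, one_mul]; exact hN.1
    exact le_mul_of_one_le_right (sq_nonneg _) h1
  exact hsq.trans hrhs

/-! ## §2 ★★★ Integration over the inner core region -/

/-- ★★★ **THE (C4)-CORE `L²` ESTIMATE.**  Let `χ = 𝟙_F·e^{−gaugeCoordSq/(powScale 1 β)²}` (measurable `F`), `N = gaugeAvg χ` with `N̄(1−κ) ≤ N ≤ N̄(1+κ)` on `F`
(`N̄(1−κ) > 0`, `κ ≥ 0`), `w = softWeight χ`; `Ω_c = 𝟙_cap·frozenProfile q r β` (`q` measurable, `q β ≥ 0`); `K` measurable; `P, P_a` bounded measurable with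
`|P| ≤ P_a`; `Z⁻¹, a₀, ε ≥ 0`; `R_in ≤ r β`; a measurable slow set `W_out`; and the pointwise core quasimode estimate at every tube point `oT u' v' ∈ F` with
`u' ∈ W_out`, `v'` cap-balanced, `‖linkEmbed v'‖ ≤ R_in`.  Then, with `ψ = Z⁻¹a₀P/N̄` and
`S_in = {U ∈ orthoTubeSet : χ U ≠ 0 ∧ ‖relLinkVec U‖ ≤ R_in ∧ slowMean U ∈ W_out}`:
`∫ 𝟙_{S_in}·(K/w − boFun ψ Ω_c)²·w ≤ (Z⁻¹a₀(ε+κ))²/(N̄(1−κ))·(∫ 𝟙_{‖x‖≤R_in} e^{−2q}e^{−‖P_Γx‖²/(powScale 1 β)²} dπ)·∫ P_a²`.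
[cite: Luscher1983, §3] [cite: SjostrandZworski2007, §2] -/
theorem defect_core_sq_integral_le (β : ℝ) {F : Set (GaugeConfig 3 L SU2)} (hF : MeasurableSet F) {χ : GaugeConfig 3 L SU2 → ℝ}
    (hχ : ∀ U, χ U = F.indicator (fun _ => (1 : ℝ)) U * Real.exp (-(gaugeCoordSq L U / powScale 1 β ^ 2)))
    {Nbar κ : ℝ} (hNκ : 0 < Nbar * (1 - κ)) (hκ : 0 ≤ κ)
    (hP : ∀ U ∈ F, Nbar * (1 - κ) ≤ gaugeAvg χ U ∧ gaugeAvg χ U ≤ Nbar * (1 + κ))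
    {q : ℝ → LinkSpace L → ℝ} (hqm : ∀ β', Measurable (q β')) (hq0 : ∀ x, 0 ≤ q β x) (r : ℝ → ℝ)
    {K : GaugeConfig 3 L SU2 → ℝ} (hKm : Measurable K)
    {P Pa : GaugeConfig 3 1 SU2 → ℝ} (hPm : Measurable P) (hPam : Measurable Pa) {CP : ℝ} (hCP : ∀ u, |Pa u| ≤ CP) (hPPa : ∀ u, |P u| ≤ Pa u)
    {Zi a₀ ε Rin : ℝ} (hZi : 0 ≤ Zi) (ha₀ : 0 ≤ a₀) (hε : 0 ≤ ε) (hRin : Rin ≤ r β)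
    {Wout : Set (GaugeConfig 3 1 SU2)} (hWout : MeasurableSet Wout)
    (hdef : ∀ u' ∈ Wout, ∀ v' ∈ capBalancedSet L, ‖linkEmbed L v'‖ ≤ Rin → orthoTube L u' v' ∈ F →
      |K (orthoTube L u' v') - Zi * (a₀ * Real.exp (-(q β (linkEmbed L v')))) * P u'| ≤
        ε * (Zi * (a₀ * Real.exp (-(q β (linkEmbed L v')))) * Pa u')) :
    ∫ U, {U : GaugeConfig 3 L SU2 | U ∈ orthoTubeSet L ∧ χ U ≠ 0 ∧ ‖relLinkVec L U‖ ≤ Rin ∧ slowMean L U ∈ Wout}.indicator (fun _ => (1 : ℝ)) U *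
        ((K U / softWeight χ U -
            boFun L (fun u' => Zi * a₀ / Nbar * P u')
              (fun x : LinkSpace L => {x : LinkSpace L | linkCurry x ∈ capBalancedSet L}.indicator (fun _ => (1 : ℝ)) x * frozenProfile L q r β x) U) ^ 2 *
          softWeight χ U) ∂configMeasure SU2 L ≤
      (Zi * a₀ * (ε + κ)) ^ 2 / (Nbar * (1 - κ)) *
        (∫ v, {v : Edge 3 L → Fin 3 → ℝ | ‖linkEmbed L v‖ ≤ Rin}.indicator (fun _ => (1 : ℝ)) v *
            (Real.exp (-(q β (linkEmbed L v))) ^ 2 * Real.exp (-(‖(gaugeModes L).starProjection (linkEmbed L v)‖ ^ 2 / powScale 1 β ^ 2))) ∂orthoTransverse L) *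
        ∫ u, Pa u ^ 2 ∂configMeasure SU2 1 := by
  haveI := isFiniteMeasure_orthoTransverse L
  set Sin : Set (GaugeConfig 3 L SU2) := {U : GaugeConfig 3 L SU2 | U ∈ orthoTubeSet L ∧ χ U ≠ 0 ∧ ‖relLinkVec L U‖ ≤ Rin ∧ slowMean L U ∈ Wout} with hSin
  set Ωc : LinkSpace L → ℝ := fun x => {x : LinkSpace L | linkCurry x ∈ capBalancedSet L}.indicator (fun _ => (1 : ℝ)) x * frozenProfile L q r β x with hΩc
  set ψ : GaugeConfig 3 1 SU2 → ℝ := fun u' => Zi * a₀ / Nbar * P u' with hψ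
  set C2 : ℝ := (Zi * a₀ * (ε + κ)) ^ 2 / (Nbar * (1 - κ)) with hC2
  set gf : (Edge 3 L → Fin 3 → ℝ) → ℝ := fun v => {v : Edge 3 L → Fin 3 → ℝ | ‖linkEmbed L v‖ ≤ Rin}.indicator (fun _ => (1 : ℝ)) v *
    (Real.exp (-(q β (linkEmbed L v))) ^ 2 * Real.exp (-(‖(gaugeModes L).starProjection (linkEmbed L v)‖ ^ 2 / powScale 1 β ^ 2))) with hgf
  set G : GaugeConfig 3 L SU2 → ℝ := fun U => Sin.indicator (fun _ => (1 : ℝ)) U * ((K U / softWeight χ U - boFun L ψ Ωc U) ^ 2 * softWeight χ U) with hG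
  have hC2nn : 0 ≤ C2 := by rw [hC2]; exact div_nonneg (sq_nonneg _) hNκ.le
  have hCP0 : 0 ≤ CP := (abs_nonneg _).trans (hCP 1)
  -- basic facts about `χ`, `N`, `w`
  have hχm : Measurable χ := by
    have : χ = fun U => F.indicator (fun _ => (1 : ℝ)) U * Real.exp (-(gaugeCoordSq L U / powScale 1 β ^ 2)) := funext hχ
    rw [this]
    exact (measurable_const.indicator hF).mul (((measurable_gaugeCoordSq L).div_const _).neg).exp
  have hχF : ∀ U, χ U ≠ 0 → U ∈ F := fun U hU => by
    by_contra h; apply hU; rw [hχ, Set.indicator_of_notMem h, zero_mul]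
  have hχ01 : ∀ U, 0 ≤ χ U ∧ χ U ≤ 1 := fun U => by
    rw [hχ]
    by_cases h : U ∈ F
    · rw [Set.indicator_of_mem h, one_mul]
      exact ⟨(Real.exp_pos _).le, Real.exp_le_one_iff.mpr (neg_nonpos.mpr (div_nonneg (gaugeCoordSq_nonneg L U) (sq_nonneg _)))⟩
    · rw [Set.indicator_of_notMem h, zero_mul]; exact ⟨le_rfl, zero_le_one⟩
  have hN0 : ∀ U, 0 ≤ gaugeAvg χ U := fun U => (gaugeAvg_mem_Icc hχm (fun V => (hχ01 V).1) (fun V => (hχ01 V).2) U).1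
  have hw0 : ∀ U, 0 ≤ softWeight χ U := fun U => div_nonneg (hN0 U) (hχ01 U).1
  -- `G ≥ 0`
  have hG0 : ∀ U, 0 ≤ G U := fun U => by
    rw [hG]; dsimp only
    by_cases h : U ∈ Sin
    · rw [Set.indicator_of_mem h, one_mul]; exact mul_nonneg (sq_nonneg _) (hw0 U)
    · rw [Set.indicator_of_notMem h, zero_mul]
  -- ★ the pointwise bound along the tube
  have hpt : ∀ (u : GaugeConfig 3 1 SU2) (v : Edge 3 L → Fin 3 → ℝ), v ∈ capBalancedSet L → G (orthoTube L u v) ≤ C2 * gf v * Pa u ^ 2 := by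
    intro u v hv
    by_cases hS : orthoTube L u v ∈ Sin
    · obtain ⟨-, hχU, hRU, hWU⟩ := hS
      rw [relLinkVec_orthoTube L u hv] at hRU
      rw [slowMean_orthoTube L u hv] at hWU
      have hUF : orthoTube L u v ∈ F := hχF _ hχU
      have hd := hdef u hWU v hv hRU hUF
      -- the values
      have hχU' : χ (orthoTube L u v) = Real.exp (-(‖(gaugeModes L).starProjection (linkEmbed L v)‖ ^ 2 / powScale 1 β ^ 2)) := by
        rw [hχ, Set.indicator_of_mem hUF, one_mul, gaugeCoordSq_orthoTube u hv]
      have hg : 0 < Real.exp (-(‖(gaugeModes L).starProjection (linkEmbed L v)‖ ^ 2 / powScale 1 β ^ 2)) := Real.exp_pos _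
      have hwU : softWeight χ (orthoTube L u v) = gaugeAvg χ (orthoTube L u v) / Real.exp (-(‖(gaugeModes L).starProjection (linkEmbed L v)‖ ^ 2 / powScale 1 β ^ 2)) := by
        rw [softWeight_eq_div, hχU']
      have hball : linkEmbed L v ∈ Metric.closedBall (0 : LinkSpace L) (r β) := by
        rw [Metric.mem_closedBall, dist_zero_right]; exact hRU.trans hRin
      have hΩv : Ωc (linkEmbed L v) = Real.exp (-(‖(gaugeModes L).starProjection (linkEmbed L v)‖ ^ 2 / powScale 1 β ^ 2)) * Real.exp (-(q β (linkEmbed L v))) := by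
        rw [hΩc]; dsimp only
        rw [Set.indicator_of_mem ((linkEmbed_mem_capLink_iff (L := L) v).2 hv), one_mul]
        unfold frozenProfile
        rw [Set.indicator_of_mem hball, mul_one]
      have hbo : boFun L ψ Ωc (orthoTube L u v) = Zi * a₀ / Nbar * P u * (Real.exp (-(‖(gaugeModes L).starProjection (linkEmbed L v)‖ ^ 2 / powScale 1 β ^ 2)) * Real.exp (-(q β (linkEmbed L v)))) := by
        rw [boFun_orthoTube L ψ Ωc u hv, hΩv]
      have hgf1 : gf v = 1 * (Real.exp (-(q β (linkEmbed L v))) ^ 2 * Real.exp (-(‖(gaugeModes L).starProjection (linkEmbed L v)‖ ^ 2 / powScale 1 β ^ 2))) := by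
        rw [hgf]; dsimp only
        rw [Set.indicator_of_mem (show v ∈ {v : Edge 3 L → Fin 3 → ℝ | ‖linkEmbed L v‖ ≤ Rin} from hRU)]
      rw [hG]; dsimp only
      rw [Set.indicator_of_mem (show orthoTube L u v ∈ Sin from ⟨orthoTube_mem L u hv, hχU, by rwa [relLinkVec_orthoTube L u hv], by rwa [slowMean_orthoTube L u hv]⟩),
        one_mul, hwU, hbo, hgf1, one_mul]
      have hreal := defect_core_pointwise (hP _ hUF) hNκ hκ hg (Real.exp_pos _).le hZi ha₀ hε (hPPa u) hd
      calc _ ≤ (Zi * a₀ * (ε + κ)) ^ 2 / (Nbar * (1 - κ)) * (Real.exp (-(q β (linkEmbed L v))) ^ 2 * Real.exp (-(‖(gaugeModes L).starProjection (linkEmbed L v)‖ ^ 2 / powScale 1 β ^ 2))) * Pa u ^ 2 := hreal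
        _ = _ := by rw [hC2]
    · rw [hG]; dsimp only
      rw [Set.indicator_of_notMem hS, zero_mul]
      have hgf0 : 0 ≤ gf v := by
        rw [hgf]; dsimp only
        by_cases h : v ∈ {v : Edge 3 L → Fin 3 → ℝ | ‖linkEmbed L v‖ ≤ Rin}
        · rw [Set.indicator_of_mem h]; positivity
        · rw [Set.indicator_of_notMem h, zero_mul]
      exact mul_nonneg (mul_nonneg hC2nn hgf0) (sq_nonneg _)
  -- measurability and boundedness of `G` (for the disintegration)
  have hψm : Measurable ψ := hPm.const_mul _
  have hΩcm : Measurable Ωc := measurable_capRestrict (L := L) (measurable_frozenProfile (q := q) hqm r β)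
  have hwm : Measurable (softWeight χ) := (measurable_gaugeAvg hχm).div hχm
  have hSm : MeasurableSet Sin := by
    rw [hSin]
    refine (measurableSet_orthoTubeSet L).inter ((hχm (measurableSet_singleton 0).compl).inter
      ((measurableSet_le (measurable_relLinkVec L).norm measurable_const).inter ?_))
    exact hWout.preimage (measurable_slowMean L)
  have hGm : Measurable G := by
    rw [hG]
    exact (measurable_const.indicator hSm).mul ((((hKm.div hwm).sub (measurable_boFun L hψm hΩcm)).pow_const 2).mul hwm)
  -- on `S_in`: `w ≥ N̄(1−κ)` (so `K/w` is bounded) and `w ≤ N̄(1+κ)·e^{|E|/ps1²}`… we bound `G` crudely by its pointwise majorant instead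
  have hGb : ∀ U, |G U| ≤ C2 * 1 * CP ^ 2 + 0 := by
    intro U
    rw [abs_of_nonneg (hG0 U), add_zero]
    by_cases hS : U ∈ Sin
    · obtain ⟨hUT, -, -, -⟩ := hS
      obtain ⟨u, v, hv, rfl⟩ := hUT
      refine (hpt u v hv).trans ?_
      have hgf1 : gf v ≤ 1 := by
        rw [hgf]; dsimp only
        by_cases h : v ∈ {v : Edge 3 L → Fin 3 → ℝ | ‖linkEmbed L v‖ ≤ Rin}
        · rw [Set.indicator_of_mem h, one_mul]
          have h1 : Real.exp (-(q β (linkEmbed L v))) ^ 2 ≤ 1 := pow_le_one₀ (Real.exp_pos _).le (Real.exp_le_one_iff.mpr (neg_nonpos.mpr (hq0 _)))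
          have h2 : Real.exp (-(‖(gaugeModes L).starProjection (linkEmbed L v)‖ ^ 2 / powScale 1 β ^ 2)) ≤ 1 :=
            Real.exp_le_one_iff.mpr (neg_nonpos.mpr (by positivity))
          calc _ ≤ 1 * 1 := mul_le_mul h1 h2 (Real.exp_pos _).le zero_le_one
            _ = 1 := one_mul _
        · rw [Set.indicator_of_notMem h, zero_mul]; exact zero_le_one
      have hgf0 : 0 ≤ gf v := by
        rw [hgf]; dsimp only
        by_cases h : v ∈ {v : Edge 3 L → Fin 3 → ℝ | ‖linkEmbed L v‖ ≤ Rin}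
        · rw [Set.indicator_of_mem h]; positivity
        · rw [Set.indicator_of_notMem h, zero_mul]
      have hPa2 : Pa u ^ 2 ≤ CP ^ 2 := by
        rw [← sq_abs]; exact pow_le_pow_left₀ (abs_nonneg _) (hCP u) 2
      exact mul_le_mul (mul_le_mul_of_nonneg_left hgf1 hC2nn) hPa2 (sq_nonneg _) (mul_nonneg hC2nn zero_le_one)
    · rw [hG]; dsimp only
      rw [Set.indicator_of_notMem hS, zero_mul]; positivity
  have hGout : ∀ U, U ∉ orthoTubeSet L → G U = 0 := fun U hU => by
    rw [hG]; dsimp only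
    rw [Set.indicator_of_notMem (fun h => hU h.1), zero_mul]
  -- disintegrate and integrate the pointwise bound
  have hdis := integral_configMeasure_orthoTube L hGm ⟨_, hGb⟩ hGout
  have hgfm : Measurable gf := by
    rw [hgf]
    refine (measurable_const.indicator (measurableSet_le (measurable_linkEmbed L).norm measurable_const)).mul ?_
    exact ((((hqm β).comp (measurable_linkEmbed L)).neg.exp).pow_const 2).mul
      ((((gaugeModes L).starProjection.continuous.measurable.comp (measurable_linkEmbed L)).norm.pow_const 2).div_const _).neg.exp
  have hgfb : ∀ v, |gf v| ≤ 1 := fun v => by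
    rw [hgf]; dsimp only
    by_cases h : v ∈ {v : Edge 3 L → Fin 3 → ℝ | ‖linkEmbed L v‖ ≤ Rin}
    · rw [Set.indicator_of_mem h, one_mul, abs_of_nonneg (by positivity)]
      have h1 : Real.exp (-(q β (linkEmbed L v))) ^ 2 ≤ 1 := pow_le_one₀ (Real.exp_pos _).le (Real.exp_le_one_iff.mpr (neg_nonpos.mpr (hq0 _)))
      have h2 : Real.exp (-(‖(gaugeModes L).starProjection (linkEmbed L v)‖ ^ 2 / powScale 1 β ^ 2)) ≤ 1 :=
        Real.exp_le_one_iff.mpr (neg_nonpos.mpr (by positivity))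
      calc _ ≤ 1 * 1 := mul_le_mul h1 h2 (Real.exp_pos _).le zero_le_one
        _ = 1 := one_mul _
    · rw [Set.indicator_of_notMem h, zero_mul, abs_zero]; exact zero_le_one
  have hIPa : Integrable (fun u => Pa u ^ 2) (configMeasure SU2 1) :=
    integrable_of_measurable_abs_le _ (hPam.pow_const 2) (C := CP ^ 2) fun u => by
      rw [abs_pow]; exact pow_le_pow_left₀ (abs_nonneg _) (hCP u) 2
  have hinner : ∀ v ∈ capBalancedSet L, ∫ u, G (orthoTube L u v) ∂configMeasure SU2 1 ≤ C2 * gf v * ∫ u, Pa u ^ 2 ∂configMeasure SU2 1 := by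
    intro v hv
    rw [← integral_const_mul]
    exact integral_mono_of_nonneg (ae_of_all _ fun u => hG0 _) (hIPa.const_mul _) (ae_of_all _ fun u => hpt u v hv)
  have hae : ∀ᵐ v ∂orthoTransverse L, v ∈ capBalancedSet L := by
    rw [ae_iff]
    exact orthoTransverse_compl_capBalancedSet L
  have hIg : Integrable (fun v => C2 * gf v * ∫ u, Pa u ^ 2 ∂configMeasure SU2 1) (orthoTransverse L) := by
    have : Integrable gf (orthoTransverse L) := integrable_of_measurable_abs_le _ hgfm hgfb
    exact (this.const_mul C2).mul_const _
  rw [hdis]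
  calc ∫ v, ∫ u, G (orthoTube L u v) ∂configMeasure SU2 1 ∂orthoTransverse L
      ≤ ∫ v, C2 * gf v * ∫ u, Pa u ^ 2 ∂configMeasure SU2 1 ∂orthoTransverse L :=
        integral_mono_of_nonneg (ae_of_all _ fun v => integral_nonneg fun u => hG0 _) hIg (hae.mono fun v hv => hinner v hv)
    _ = C2 * (∫ v, gf v ∂orthoTransverse L) * ∫ u, Pa u ^ 2 ∂configMeasure SU2 1 := by
        rw [integral_mul_const, integral_const_mul]

end Summit.QuantumFields.YangMills.Theorems.FemtoTransferGap.TwoLattice.ConstTube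

end
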